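import Summits.BirchSwinnertonDyer.BirchSwinnertonDyer.Theorems.ErratumRoadFiveEulerHalfNotRamNoInertSetOfLowerX11aFive
import Summits.BirchSwinnertonDyer.BirchSwinnertonDyer.Theorems.ErratumRoadFiveEulerHalfNotRamNoInertSetOfAuxNorm
import Summits.BirchSwinnertonDyer.BirchSwinnertonDyer.Theorems.ErratumRoadFiveAuxNormTateComponentFamily
import Summits.BirchSwinnertonDyer.BirchSwinnertonDyer.Theorems.ErratumRoadFiveAuxPrimeChebotarevKummerSupply
import Summits.BirchSwinnertonDyer.BirchSwinnertonDyer.Theorems.ErratumRoadFiveAuxPrimeSplitPrimeKummerWitness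
import Summits.BirchSwinnertonDyer.BirchSwinnertonDyer.Theorems.ErratumRoadFiveEulerHalfNotRamNoInertSetOfGalTrivialRoad
import HarnessLib

/-!
# Route `ErratumRoadFive` (K2, `p ≥ 5`), crux `EulerHalfNotRamNoInertSetAtFive` (item stmt-BirchSwinnertonDyer-19715), line `birth` v16 → v17:
# THE CRUX BY NAME FROM SIX ROUTE ITEMS + THE `p ≥ 5` RESTRICTION OF `X11aLowerHalf` (both roads)
# (cell `bsd-stepL`, LEAD `bsd-line-er5-p1` g4; `--supports stmt-BirchSwinnertonDyer-19715 --as helper`; companion of `…NoInertSetOfLowerX11aFive`)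

WHAT. The closers over `…EulerHalfNotRamNoInertSetOfLowerX11aFive` §3 (the branching composition with the X11a lower half asked only at `p ≥ 5`):
* §4 `eulerHalfNotRamNoInertSetAtFive_of_sixItems_of_lowerX11aFive` (ROAD A: SAV from the LEAD g3's
  `EulerHalfAuxNorm.shimuraInertSavedDisplayAtFive_of_items_of_threeLeaves` over the width seats' tree theorems S1-lin ∕ (C) ∕ (O), as p651418) and
  `…_roadB` (ROAD B: -w6 g0's `EulerHalfGalTrivialRoad.shimuraInertSavedDisplayAtFive_of_items`, as p650861): **crux 19715 BY NAME from the SIX route items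
  {19066 `PublishedInputsFive`, 19524, 19716 `PastenComponentOrdersInput`, 20191 `ShimuraCasselsTateLevelInputs`, 20442, 27981 `EulerHalfGrossPrintFacts`} +
  `∀ Wd p, ClassX11a Wd p → 5 ≤ p → MissingLowerBoundAt Wd p`** (the part of crux 19064 `X11aLowerHalf` that 19715 uses); `lowerX11aFive_of_x11aLowerHalf`
  records that the item implies its restriction, so the seven-item statement of v16 (p651418 ∕ p650861; also `Theorems.eulerHalfNotRamNoInertSetAtFive_of`)
  follows by composition (not restated: dedup).
* COMPOSITION WITH THE 19064 LINE (not restated here, to stay on ONE fact vocabulary): the 19064 line's width seat bsd-line-er5-p2 supplies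
  `Birth.lowerX11aFive_of_children_r16_three (h9) (h8L) (hμ5) : ∀ W p, ClassX11a W p → 5 ≤ p → MissingLowerBoundAt W p` keyed on the REGISTERED r16
  children texts of crux 19064 (`stub_nineFactsOddGS`, `stub_chainFactsLower`, `stub_muAnDeepFive`); then
  `eulerHalfNotRamNoInertSetAtFive_of_sixItems_of_lowerX11aFive h₅ hJL hCO hCTi hESi hF2 (Birth.lowerX11aFive_of_children_r16_three h9 h8L hμ5)` is
  **crux 19715 modulo the six ER5 items + THREE of 19064's five children** (print ×2 + ONE `∀`-certificate statement: Greenberg's analytic `μ = 0` on the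
  deep X11a pairs at `p ≥ 5`); 19064's two `p = 3` children (`stub_threePartnerFactsLower`, `stub_mazurMCAtTresRamifieThree`) are outside the cone.

WHY (LEAD g4, 2026-08-28). After v16 (crux closed modulo SEVEN route items, 0 stub) the open mathematics of 19715 is «published inputs + crux 19064»; this
pair of files makes the dependence on 19064 exact: only its `p ≥ 5` restriction is consumed (at the pair's own prime). Whether the skeleton's `_of` binder
is re-typed (a `p ≥ 5` child ∕ alias of 19064 filed as an item of ER5 or PrintX11a) is the planners' call; until then these are helpers and `_of` keeps
`X11aLowerHalf` by name (RULING 67 end state respected).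

HONEST FRAMING: THEOREMS ONLY — no definition, no named fact, no `sorry`; every theorem is CONDITIONAL on its displayed binders (route items by name =
published inputs typed as named facts; the `p ≥ 5` X11a restriction — OPEN, it contains Greenberg's `μ`-conjecture on the deep X11a locus at `p ≥ 5`). Nothing is booked; item 19715 is NOT closed (exact-match close only); no census number moves
(404 = 69 + 334 + 1 + 0); BSD is proved for no curve; no summit statement is touched.
[cite: Jetchev2008, Thm. 1.1, Thm. 1.4, Cor. 1.5 (p. 812)] [cite: PastenShimura2024, Prop. 6.13, Lemma 6.18, §6.6] [cite: GrossLMS1991, Prop. 3.7 (2) (p. 240), §6 (p. 245)]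
[cite: Cox2013, Thm. 8.12, §9.A] [cite: Miller2011LMS, §1, Def. 1.1]
-/

set_option autoImplicit false
set_option linter.dupNamespace false -- `Summit.BirchSwinnertonDyer.BirchSwinnertonDyer` (summit = problem), tree-wide

noncomputable section

open scoped Classical

/-! ### §4 The crux BY NAME from SIX route items + the `p ≥ 5` X11a lower half (both roads); monotonicity -/

namespace Summit.BirchSwinnertonDyer.BirchSwinnertonDyer.Theorems.EulerHalfLowerX11aFive

open Summit.BirchSwinnertonDyer.BirchSwinnertonDyer.Theses.ErratumRoadFive
open Literature.NumberTheory.EllipticCurves Literature.NumberTheory.EllipticCurves.Rank1Residual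
  Literature.NumberTheory.EllipticCurves.Rank1Residual.Typed
open Summit.BirchSwinnertonDyer.Rank1Residual Summit.BirchSwinnertonDyer.BirchSwinnertonDyer
  Summit.BirchSwinnertonDyer.BirchSwinnertonDyer.Theorems

/-- The route item `X11aLowerHalf` (19064; ALL odd `p`) implies its `p ≥ 5` restriction — so every `…_of_lowerX11aFive` theorem of this file is
at least as strong as its seven-item original. Bookkeeping. [cite: Miller2011LMS, Def. 1.1] -/
theorem lowerX11aFive_of_x11aLowerHalf (h₃ : X11aLowerHalf) :
    ∀ (Wd : WeierstrassCurve ℚ) [Wd.IsElliptic] [Wd.IsGloballyMinimal] (p : ℕ) [Fact p.Prime],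
      ClassX11a Wd p → 5 ≤ p → MissingLowerBoundAt Wd p :=
  fun Wd _ _ p _ hXa _ ↦ h₃ Wd p hXa

/-- **CRUX 19715 `EulerHalfNotRamNoInertSetAtFive` BY NAME FROM SIX ROUTE ITEMS + THE `p ≥ 5` RESTRICTION OF `X11aLowerHalf` — ROAD A.**
`PublishedInputsFive` (19066), `ShimuraParametrizationDataNonempty` (19524), `PastenComponentOrdersInput` (19716), `ShimuraCasselsTateLevelInputs`
(20191), `ShimuraHeegnerEulerSystemInertPrintedR` (20442), `EulerHalfGrossPrintFacts` (27981), and `∀ Wd p, ClassX11a Wd p → 5 ≤ p →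
MissingLowerBoundAt Wd p` (the part of crux 19064 this crux uses). := §3 fed with the LEAD g3's SAV supplier
`EulerHalfAuxNorm.shimuraInertSavedDisplayAtFive_of_items_of_threeLeaves` over the width seats' tree theorems S1-lin ∕ (C) ∕ (O) (as p651418).
CONDITIONAL on the displayed inputs; item 19715 stays ledger-`open`; BSD is proved for no curve.
[cite: GrossLMS1991, §6 p. 245] [cite: Jetchev2008, Thm. 1.4, Cor. 1.5] [cite: PastenShimura2024, Lemma 6.18, Prop. 6.13] [cite: Cox2013, Thm. 8.12, §9.A] -/
theorem eulerHalfNotRamNoInertSetAtFive_of_sixItems_of_lowerX11aFive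
    (h₅ : PublishedInputsFive) (hJL : ShimuraParametrizationDataNonempty)
    (hCO : PastenComponentOrdersInput) (hCTi : ShimuraCasselsTateLevelInputs)
    (hESi : ShimuraHeegnerEulerSystemInertPrintedR) (hF2 : EulerHalfGrossPrintFacts)
    (h₃ : ∀ (Wd : WeierstrassCurve ℚ) [Wd.IsElliptic] [Wd.IsGloballyMinimal] (p : ℕ) [Fact p.Prime],
      ClassX11a Wd p → 5 ≤ p → MissingLowerBoundAt Wd p) :
    EulerHalfNotRamNoInertSetAtFive :=
  EulerHalfBirthAssembly.eulerHalfNotRamNoInertSetAtFive_of_items_of_twoPrintFacts_of_SAV_of_lowerX11aFive h₅ h₃ hJL hCO hCTi hESi hF2.1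
    (Gross1991_heegnerPoint_sub_ratTorsion_mem_E0_of_imageFree hF2.2)
    (EulerHalfAuxNorm.shimuraInertSavedDisplayAtFive_of_items_of_threeLeaves h₅ hCTi hESi
      (fun W _ _ K _ _ ι _ hK q _ hs hq2 ↦ TateComponent.stub_tateComponentFamilyLinear W K ι hK q hs hq2)
      (fun W _ _ K _ _ hK hdK p _ hp5 hsurj ↦ stub_chebotarevKummerSupply W K hK hdK p hp5 hsurj)
      (fun K _ _ hK hdK p _ hp3 q _ hq2 ↦ stub_splitPrimeKummerWitness K hK hdK p hp3 q hq2))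

/-- **The same, ROAD B** (width seat -w6 g0's Galois-trivial ∕ kills road: SAV supplier `EulerHalfGalTrivialRoad.shimuraInertSavedDisplayAtFive_of_items`,
p650861). CONDITIONAL on the displayed inputs; item 19715 stays ledger-`open`; BSD is proved for no curve.
[cite: GrossLMS1991, §6 p. 245] [cite: Jetchev2008, Thm. 1.4, Cor. 1.5] [cite: PastenShimura2024, Lemma 6.18, Prop. 6.13] -/
theorem eulerHalfNotRamNoInertSetAtFive_of_sixItems_of_lowerX11aFive_roadB
    (h₅ : PublishedInputsFive) (hJL : ShimuraParametrizationDataNonempty)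
    (hCO : PastenComponentOrdersInput) (hCTi : ShimuraCasselsTateLevelInputs)
    (hESi : ShimuraHeegnerEulerSystemInertPrintedR) (hF2 : EulerHalfGrossPrintFacts)
    (h₃ : ∀ (Wd : WeierstrassCurve ℚ) [Wd.IsElliptic] [Wd.IsGloballyMinimal] (p : ℕ) [Fact p.Prime],
      ClassX11a Wd p → 5 ≤ p → MissingLowerBoundAt Wd p) :
    EulerHalfNotRamNoInertSetAtFive :=
  EulerHalfBirthAssembly.eulerHalfNotRamNoInertSetAtFive_of_items_of_twoPrintFacts_of_SAV_of_lowerX11aFive h₅ h₃ hJL hCO hCTi hESi hF2.1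
    (Gross1991_heegnerPoint_sub_ratTorsion_mem_E0_of_imageFree hF2.2)
    (EulerHalfGalTrivialRoad.shimuraInertSavedDisplayAtFive_of_items h₅ hCTi hESi)

end Summit.BirchSwinnertonDyer.BirchSwinnertonDyer.Theorems.EulerHalfLowerX11aFive

end
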